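import Mathlib
import Summits.ValiantsHypothesis.ValiantsHypothesis.Theorems.LacunarySymmetroidMatrixDescartesStubInertiaChain

/-!
# Crux `DerivedPencilRolleQuasi` (stmt-ValiantsHypothesis-18064), PSD sector with MULTIPLICITY —
# part 2: the grouped inertia chain (kernel SUBSPACES at increasing times are independent)

Let `G : ℝ → Matrix ι ι ℝ` be a family of real symmetric matrices, Loewner non-decreasing on
`(0, ∞)`, with the STRICTNESS property that every nonzero kernel vector `y` of `G t` (`t > 0`) has
`0 < y ⬝ᵥ G s y` at all later times `s > t`.  Then kernel vectors taken at finitely many positive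
times are jointly linearly independent; in particular (`sum_card_le`) linearly independent kernel
families `v t : κ t → ker G t`, `t ∈ R`, satisfy `∑_{t ∈ R} card (κ t) ≤ card ι`.

This is the tree's inertia chain `LacunarySymmetroidMatrixDescartes.stub_inertiaChain` (one kernel
vector per time) upgraded from vectors to subspaces; the induction (`chain_quadForm_pos`) is on the
maximal time of the finset `R` (`Finset.induction_on_max`): at the top time `T` the cross terms of
the quadratic form vanish (`G T y = 0`, symmetry), earlier contributions are positive at time `T` by
induction and stay positive later by Loewner monotonicity, and a lone top contribution is positive
by strictness.  Used with multiplicity = nullity (part 1) to count positive roots WITH multiplicity.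
-/

-- single-conjunct layout: Sub = Summit, duplicated namespace component intended
set_option linter.dupNamespace false

namespace Summit.ValiantsHypothesis.ValiantsHypothesis.Theorems.SymmetroidDescartes

namespace DerivedPencilRolleQuasiPsdSectorMult

open Matrix Finset
open scoped BigOperators

variable {ι : Type*} [Fintype ι]

/-- **Grouped inertia chain, quantitative form.**  For a symmetric, Loewner non-decreasing, strict
family `G` (see the module doc), kernel vectors `x t ∈ ker G t` attached to the times of a finset
`R ⊆ (0,∞)`, not all zero, have a sum whose `G s`-quadratic form is positive at every time `s`
beyond `R`. -/
theorem chain_quadForm_pos (G : ℝ → Matrix ι ι ℝ) (hG : ∀ s, (G s).IsSymm)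
    (hmono : ∀ s t : ℝ, 0 < s → s ≤ t → (G t - G s).PosSemidef)
    (hstrict : ∀ t : ℝ, 0 < t → ∀ y : ι → ℝ, G t *ᵥ y = 0 → y ≠ 0 →
      ∀ s : ℝ, t < s → 0 < y ⬝ᵥ (G s *ᵥ y))
    (R : Finset ℝ) (hR : ∀ t ∈ R, 0 < t) (x : ℝ → ι → ℝ) (hx : ∀ t ∈ R, G t *ᵥ x t = 0)
    (hne : ∃ t ∈ R, x t ≠ 0) (s : ℝ) (hs : ∀ t ∈ R, t < s) :
    0 < (∑ t ∈ R, x t) ⬝ᵥ (G s *ᵥ ∑ t ∈ R, x t) := by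
  classical
  induction R using Finset.induction_on_max generalizing s with
  | empty =>
      obtain ⟨t, ht, _⟩ := hne
      exact absurd ht (Finset.notMem_empty t)
  | insert T R hT ih =>
      have hTR : T ∉ R := fun h => lt_irrefl T (hT T h)
      have hTmem : T ∈ insert T R := Finset.mem_insert_self T R
      have hTpos : 0 < T := hR T hTmem
      have hTs : T < s := hs T hTmem
      have hyker : G T *ᵥ x T = 0 := hx T hTmem
      rw [Finset.sum_insert hTR]
      -- write the sum as `u + 1 • y` with `y = x T` the top kernel vector
      have e1 : x T + ∑ t ∈ R, x t = (∑ t ∈ R, x t) + (1 : ℝ) • x T := by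
        rw [one_smul, add_comm]
      rw [e1]
      by_cases hR0 : ∃ t ∈ R, x t ≠ 0
      · -- earlier contributions: positive at time `T` by induction, then monotone
        have hu : 0 < (∑ t ∈ R, x t) ⬝ᵥ (G T *ᵥ ∑ t ∈ R, x t) :=
          ih (fun t ht => hR t (Finset.mem_insert_of_mem ht))
            (fun t ht => hx t (Finset.mem_insert_of_mem ht)) hR0 T hT
        calc (0 : ℝ) < (∑ t ∈ R, x t) ⬝ᵥ (G T *ᵥ ∑ t ∈ R, x t) := hu
          _ = ((∑ t ∈ R, x t) + (1 : ℝ) • x T) ⬝ᵥ (G T *ᵥ ((∑ t ∈ R, x t) + (1 : ℝ) • x T)) :=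
            (LacunarySymmetroidMatrixDescartes.StubInertiaChain.quadForm_add_smul_of_mulVec_eq_zero
              (hG T) hyker _ _).symm
          _ ≤ ((∑ t ∈ R, x t) + (1 : ℝ) • x T) ⬝ᵥ (G s *ᵥ ((∑ t ∈ R, x t) + (1 : ℝ) • x T)) :=
            LacunarySymmetroidMatrixDescartes.StubInertiaChain.quadForm_mono
              (hmono T s hTpos hTs.le) _
      · -- only the top vector survives: strictness
        push Not at hR0
        have hu0 : ∑ t ∈ R, x t = 0 := Finset.sum_eq_zero fun t ht => hR0 t ht
        have hy0 : x T ≠ 0 := by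
          obtain ⟨t, ht, hxt⟩ := hne
          rcases Finset.mem_insert.1 ht with rfl | htR
          · exact hxt
          · exact absurd (hR0 t htR) hxt
        rw [hu0, zero_add, one_smul]
        exact hstrict T hTpos (x T) hyker hy0 s hTs

/-- **Kernel vectors at distinct positive times are independent**: with `G` as above, if kernel
vectors `x t ∈ ker G t` (`t ∈ R ⊆ (0,∞)`) sum to zero then each of them is zero. -/
theorem kernel_sum_eq_zero (G : ℝ → Matrix ι ι ℝ) (hG : ∀ s, (G s).IsSymm)
    (hmono : ∀ s t : ℝ, 0 < s → s ≤ t → (G t - G s).PosSemidef)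
    (hstrict : ∀ t : ℝ, 0 < t → ∀ y : ι → ℝ, G t *ᵥ y = 0 → y ≠ 0 →
      ∀ s : ℝ, t < s → 0 < y ⬝ᵥ (G s *ᵥ y))
    (R : Finset ℝ) (hR : ∀ t ∈ R, 0 < t) (x : ℝ → ι → ℝ) (hx : ∀ t ∈ R, G t *ᵥ x t = 0)
    (hsum : ∑ t ∈ R, x t = 0) : ∀ t ∈ R, x t = 0 := by
  by_contra hcon
  push Not at hcon
  have hs : ∀ t ∈ R, t < (∑ t ∈ R, t) + 1 := fun t ht =>
    (Finset.single_le_sum (f := fun t => t) (fun t ht => (hR t ht).le) ht).trans_lt (lt_add_one _)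
  have h := chain_quadForm_pos G hG hmono hstrict R hR x hx hcon _ hs
  rw [hsum, zero_dotProduct] at h
  exact lt_irrefl 0 h

/-- **Grouped inertia chain, counting form.**  With `G` as above, linearly independent families of
kernel vectors `v t : κ t → ker G t` at the positive times `t ∈ R` are JOINTLY linearly
independent, so `∑_{t ∈ R} card (κ t) ≤ card ι`. -/
theorem sum_card_le (G : ℝ → Matrix ι ι ℝ) (hG : ∀ s, (G s).IsSymm)
    (hmono : ∀ s t : ℝ, 0 < s → s ≤ t → (G t - G s).PosSemidef)
    (hstrict : ∀ t : ℝ, 0 < t → ∀ y : ι → ℝ, G t *ᵥ y = 0 → y ≠ 0 →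
      ∀ s : ℝ, t < s → 0 < y ⬝ᵥ (G s *ᵥ y))
    (R : Finset ℝ) (hR : ∀ t ∈ R, 0 < t) {κ : ℝ → Type*} [∀ t, Fintype (κ t)]
    (v : (t : ℝ) → κ t → (ι → ℝ)) (hker : ∀ t ∈ R, ∀ i, G t *ᵥ v t i = 0)
    (hli : ∀ t ∈ R, LinearIndependent ℝ (v t)) :
    ∑ t ∈ R, Fintype.card (κ t) ≤ Fintype.card ι := by
  classical
  -- the combined family, indexed by the sigma type over `R`
  have hf : LinearIndependent ℝ (fun q : (Σ t : R, κ t) => v q.1 q.2) := by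
    rw [Fintype.linearIndependent_iff]
    intro g hg
    -- group the combination by time
    let x : ℝ → ι → ℝ := fun t => if ht : t ∈ R then ∑ i, g ⟨⟨t, ht⟩, i⟩ • v t i else 0
    have hxR : ∀ (t : ℝ) (ht : t ∈ R), x t = ∑ i, g ⟨⟨t, ht⟩, i⟩ • v t i := fun t ht => by
      simp [x, ht]
    have hx : ∀ t ∈ R, G t *ᵥ x t = 0 := by
      intro t ht
      rw [hxR t ht, Matrix.mulVec_sum]
      exact Finset.sum_eq_zero fun i _ => by rw [Matrix.mulVec_smul, hker t ht i, smul_zero]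
    have hsum : ∑ t ∈ R, x t = 0 := by
      rw [← hg, ← Finset.sum_coe_sort R x, Fintype.sum_sigma]
      exact Finset.sum_congr rfl fun t _ => by rw [hxR t t.2]
    have hx0 := kernel_sum_eq_zero G hG hmono hstrict R hR x hx hsum
    rintro ⟨t, i⟩
    have h1 : ∑ j, g ⟨t, j⟩ • v t j = 0 := by
      rw [← hxR t t.2]
      exact hx0 t t.2
    exact (Fintype.linearIndependent_iff.1 (hli t t.2)) (fun j => g ⟨t, j⟩) h1 i
  have hcard := hf.fintype_card_le_finrank
  rw [Module.finrank_fintype_fun_eq_card, Fintype.card_sigma] at hcard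
  rwa [← Finset.sum_coe_sort R (fun t => Fintype.card (κ t))]

end DerivedPencilRolleQuasiPsdSectorMult

end Summit.ValiantsHypothesis.ValiantsHypothesis.Theorems.SymmetroidDescartes
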